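import Summits.HodgeConjecture.CorCM.MultiFieldWeilJointPrimes
import Summits.HodgeConjecture.CorCM.MultiFieldWeilMarkmanIntrinsic
import HarnessLib

/-!
# MULTI-FIELD WEIL ENGINE — JOINT PRIMES, THE HEADLINES: a tower of PRIME relative degrees with repetitions and ANY types, `Aut(ℂ/k)` jointly transitive on the tuples
# of `τ`-embeddings within each degree (NO order), over one-member fields of pairwise coprime degrees; and ANY NUMBER of sextic `(1,2)` / decic `(2,3)` CM fields
# sharing `k` with jointly transitive embeddings — the Hodge conjecture for every product of copies GIVEN ONLY Markman's theorems

Cell `pub-hodgecm2` (COR-CM), seat b30 gen 30 (2026-08-24); count-neutral own lane MULTI-FIELD WEIL ENGINE (stem `MultiFieldWeil*`), sequel of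
`CorCM/MultiFieldWeilJointPrimes.lean` (the defect law `exists_hasDefectsG_realisedTuples_of_jointPrimeTower_oneMember`) and `CorCM/MultiFieldWeilMarkmanIntrinsic.lean`
(the frame-free Markman suppliers).  Theorems only; no definition, no named fact of its own, no `sorry`, no frames in §2–§3.  HONEST FRAMING: §1 is CONDITIONAL on the
displayed single-slot Weil spaces `hW m` (Markman for `(n_m, p_m) ∈ {(3,1), (5,2)}` inside a tower, OPEN beyond); §2–§3 are conditional ONLY on the displayed Markman
named facts.  `HC_CM` is NOT proved and not asserted.

* §1 **`hodgeConjectureFor_biproduct_comp_of_jointPrimeTower_oneMember`** (frame form, + dominated, + `_intrinsic`): `E ⊨ (k; {τ})`, `B_m ⊨ (K_m; Φ_m)`; slots of `L` with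
  ONE member over `τ` and pairwise coprime `n_m`; slots outside `L` of PRIME `n_m` larger than those of `L`, ANY types (`0 < p_m`, `2p_m ≤ n_m`), and for every prime
  occurring at least twice `Aut(ℂ/τ(k))` JOINTLY TRANSITIVE on the tuples of `τ`-embeddings of the fields of that degree (`hJ` — e.g. their Galois closures over `k`
  linearly disjoint): the Hodge conjecture for EVERY product of copies `⨁_j A(κ j)` GIVEN the single-slot Weil spaces.  No order, no priority in the statement.
* §2 **`hodgeConjectureFor_biproduct_comp_of_sextics`**: ANY NUMBER of `(1,2)`-threefolds `T_m` over SEXTIC CM fields `K_m ∋ k` with `Aut(ℂ/τ(k))` jointly transitive on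
  the tuples of `τ`-embeddings `(s_m)_m` (for two fields: `K_0 ≇ K_1`; in general: `K_0 ⊗_k ⋯ ⊗_k K_{r−1}` a field suffices): HC of EVERY product of copies of
  `E, T_0, …, T_{r−1}` GIVEN ONLY Markman's fourfold theorem.  **`…_of_decics`**: `(2,3)`-fivefolds over DECIC fields, GIVEN ONLY the hyperbolic-sixfold theorem.
* §3 **`hodgeConjectureFor_biproduct_comp_of_sexticsDecics`** (+ dominated): both degrees at once, joint transitivity within each degree.
[cite: Pohlmann1968, Thm 1] [cite: Milne2020HodgeClassesAV, 1.2 (a) and Thm. 1] [cite: MoonenZarhin1995Duke, Thm. 2.4] [cite: DixonMortimer1996, §1.6 and Thm. 1.6A]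
[cite: Markman2025SurveySecant, Thm. 1.2] [cite: Markman2025SecantWeil, Thm 1.5.1] [cite: Shimura1998, §18.2 Lemma (i)] [cite: MumfordAV1970, §19]

## References
* [Pohlmann1968] H. Pohlmann, Ann. of Math. 88 (1968), Thm 1.  [Milne2020HodgeClassesAV] J. S. Milne, arXiv:2010.08857, 1.2 (a), Thm. 1.  [MoonenZarhin1995Duke]
  B. Moonen, Yu. Zarhin, Duke Math. J. 77 (1995), Thm. 2.4.  [DixonMortimer1996] J. D. Dixon, B. Mortimer, *Permutation Groups*, GTM 163, §1.6, Thm. 1.6A.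
  [Markman2025SurveySecant] E. Markman, arXiv:2509.23403, Thm. 1.2.  [Markman2025SecantWeil] E. Markman, Cycles on abelian 2n-folds of Weil type from secant sheaves on
  abelian n-folds, Thm 1.5.1.  [Shimura1998] G. Shimura, *Abelian varieties with CM and modular functions*, §18.2 Lemma (i).  [MumfordAV1970] D. Mumford, *Abelian
  Varieties*, §19.
-/

noncomputable section

open CategoryTheory CategoryTheory.Limits NumberField

namespace Summit.HodgeConjecture.CorCM.MultiFieldWeil

open Finset
open Literature.AlgebraicGeometry Literature.AlgebraicGeometry.Motives Literature.AlgebraicGeometry.HodgeTheory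
open Literature.AlgebraicGeometry.ComplexMultiplication (IsCMTypeRealisation)
open Literature.AlgebraicTopology.SingularHomology
open Literature.NumberTheory.ComplexMultiplication
open Summit.HodgeConjecture.CorCM.Census.MultiFieldWeil

open scoped Classical

variable {I : Type} {r : ℕ} {Kf : I → Type} [∀ i, Field (Kf i)] [∀ i, NumberField (Kf i)] [∀ i, IsCMField (Kf i)]
  {i₀ : I} {is : Fin r → I} {n : Fin r → ℕ} {τ : Kf i₀ →+* ℂ}
  {A : Fin (r + 1) → AbelianVariety ℂ} {Φ : ∀ j : Fin (r + 1), CMType (Kf (mfSlots i₀ is j))}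
  {ι : ∀ j, 𝓞 (Kf (mfSlots i₀ is j)) →+* End (A j)}
  {θ : ∀ j, Kf (mfSlots i₀ is j) →+* Module.End ℂ (complexBetti (A j).X 1)}

/-! ## §1 The joint prime tower over coprime one-member slots -/

/-- **HEADLINE — A TOWER OF PRIME RELATIVE DEGREES WITH REPETITIONS AND ANY TYPES, JOINTLY TRANSITIVE EMBEDDINGS WITHIN EACH DEGREE, OVER ONE-MEMBER FIELDS OF
PAIRWISE COPRIME RELATIVE DEGREES.**  `k = Kf i₀` imaginary quadratic, `E = A 0 ⊨ (k; {τ})` (`τ(δ) = i√d`), `B_m = A (m+1) ⊨ (K_m; Φ (m+1))` over `K_m ⊇ i_m(k)`,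
`n_m = [K_m : k]`, types read by frames `e m` at position sets `P m` of sizes `p_m` (`0 < p_m`, `2p_m ≤ n_m`).  Slots of `L`: `p_m = 1`, `n_m` pairwise coprime.  Slots
outside `L`: `n_m` PRIME, larger than the `n_{m'}` (`m' ∈ L`); for every such slot `m₀` with another slot of the same degree, `Aut(ℂ/τ(k))` is JOINTLY TRANSITIVE on the
tuples of `τ`-embeddings of the fields of that degree (`hJ`).  Then the Hodge conjecture holds for EVERY product of copies `⨁_j A(κ j)` GIVEN the single-slot Weil spaces
`hW m`.  No order among the fields.  `HC_CM` is NOT asserted. [cite: Pohlmann1968, Thm 1] [cite: Milne2020HodgeClassesAV, 1.2 (a) and Thm. 1]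
[cite: MoonenZarhin1995Duke, Thm. 2.4] [cite: DixonMortimer1996, §1.6 and Thm. 1.6A] -/
theorem hodgeConjectureFor_biproduct_comp_of_jointPrimeTower_oneMember (P : ∀ m : Fin r, Finset (Fin (n m))) (p : Fin r → ℕ)
    (hcard : ∀ m, (P m).card = p m) (L : Finset (Fin r)) (hpr : ∀ m, m ∉ L → (n m).Prime)
    (hLt : ∀ m ∈ L, ∀ m', m' ∉ L → n m < n m') (hcop : ∀ m ∈ L, ∀ m' ∈ L, m ≠ m' → (n m).Coprime (n m'))
    (hp1 : ∀ m ∈ L, p m = 1) (hp0 : ∀ m, 0 < p m) (hpn : ∀ m, 2 * p m ≤ n m)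
    {N : ℕ} (κ : Fin N → Fin (r + 1)) (h2 : Module.finrank ℚ (Kf i₀) = 2) (im : ∀ m : Fin r, Kf i₀ →+* Kf (is m))
    (hJ : ∀ m₀, m₀ ∉ L → (∃ m, m ∉ L ∧ m ≠ m₀ ∧ n m = n m₀) →
      ∀ s s' : (∀ m : Fin r, Kf (is m) →+* ℂ), (∀ m, m ∉ L → n m = n m₀ → (s m).comp (im m) = τ ∧ (s' m).comp (im m) = τ) →
        ∃ ρ : ℂ ≃+* ℂ, ∀ m, m ∉ L → n m = n m₀ → (ρ : ℂ →+* ℂ).comp (s m) = s' m)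
    {δ : 𝓞 (Kf i₀)} {d : ℕ} (hτ : τ (δ : Kf i₀) = Complex.I * (Real.sqrt d : ℂ))
    (hA : ∀ j, IsCMTypeRealisation (Φ j) (A j) (ι j) (θ j))
    (e : ∀ m : Fin r, (Kf (is m) →+* ℂ) ≃ Fin (n m) × Bool)
    (he_sign : ∀ (m : Fin r) (s : Kf (is m) →+* ℂ), (e m s).2 = true ↔ s.comp (im m) = τ)
    (he_conj : ∀ (m : Fin r) (s : Kf (is m) →+* ℂ), e m (ComplexEmbedding.conjugate s) = ((e m s).1, !(e m s).2))
    (hΨ : ∀ σ : Kf i₀ →+* ℂ, σ ∈ (Φ 0).1 ↔ σ = τ)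
    (hΦ : ∀ (m : Fin r) (s : Kf (is m) →+* ℂ), s ∈ (Φ m.succ).1 ↔ (e m s).2 = decide ((e m s).1 ∈ P m))
    (hW : ∀ m : Fin r, weilClassesOf (⨁ fun i => A (partSlots (n m - 2 * p m) m i))
      (biproduct.map fun i => ι (partSlots (n m - 2 * p m) m i) (δfam im δ (partSlots (n m - 2 * p m) m i))) (n m - p m) d ≤
      algebraicClasses (⨁ fun i => A (partSlots (n m - 2 * p m) m i)).X (n m - p m)) :
    HodgeConjectureFor (⨁ fun j => A (κ j)).dim (⨁ fun j => A (κ j)).X :=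
  hodgeConjectureFor_biproduct_comp_of_defectLawG (is := is) P (fun m => n m - 2 * p m) (fun m => n m - p m)
    (fun m => by have := hpn m; omega) (fun m => by have := hp0 m; have := hpn m; omega) κ h2 im hτ hA e he_sign he_conj hΨ hΦ
    (fun v T hT => exists_hasDefectsG_realisedTuples_of_jointPrimeTower_oneMember (e := e) he_sign L hpr hLt hcop hJ
      (fun m hm => Finset.card_eq_one.1 (by rw [hcard m, hp1 m hm]))
      (fun m _ => Finset.card_pos.1 (by rw [hcard m]; exact hp0 m)) (fun m _ => by have := hpn m; have := hp0 m; rw [hcard m]; omega)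
      (fun m => n m - 2 * p m) (cast_sub_two_mul_eq hcard hpn) v T hT) hW

/-- **… and for every abelian variety DOMINATED by such a product.** `HC_CM` is NOT asserted. [cite: MumfordAV1970, §19] [cite: Pohlmann1968, Thm 1] -/
theorem hodgeConjectureFor_of_avDominatedBy_comp_of_jointPrimeTower_oneMember (P : ∀ m : Fin r, Finset (Fin (n m))) (p : Fin r → ℕ)
    (hcard : ∀ m, (P m).card = p m) (L : Finset (Fin r)) (hpr : ∀ m, m ∉ L → (n m).Prime)
    (hLt : ∀ m ∈ L, ∀ m', m' ∉ L → n m < n m') (hcop : ∀ m ∈ L, ∀ m' ∈ L, m ≠ m' → (n m).Coprime (n m'))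
    (hp1 : ∀ m ∈ L, p m = 1) (hp0 : ∀ m, 0 < p m) (hpn : ∀ m, 2 * p m ≤ n m)
    {N : ℕ} (κ : Fin N → Fin (r + 1)) (h2 : Module.finrank ℚ (Kf i₀) = 2) (im : ∀ m : Fin r, Kf i₀ →+* Kf (is m))
    (hJ : ∀ m₀, m₀ ∉ L → (∃ m, m ∉ L ∧ m ≠ m₀ ∧ n m = n m₀) →
      ∀ s s' : (∀ m : Fin r, Kf (is m) →+* ℂ), (∀ m, m ∉ L → n m = n m₀ → (s m).comp (im m) = τ ∧ (s' m).comp (im m) = τ) →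
        ∃ ρ : ℂ ≃+* ℂ, ∀ m, m ∉ L → n m = n m₀ → (ρ : ℂ →+* ℂ).comp (s m) = s' m)
    {δ : 𝓞 (Kf i₀)} {d : ℕ} (hτ : τ (δ : Kf i₀) = Complex.I * (Real.sqrt d : ℂ))
    (hA : ∀ j, IsCMTypeRealisation (Φ j) (A j) (ι j) (θ j))
    (e : ∀ m : Fin r, (Kf (is m) →+* ℂ) ≃ Fin (n m) × Bool)
    (he_sign : ∀ (m : Fin r) (s : Kf (is m) →+* ℂ), (e m s).2 = true ↔ s.comp (im m) = τ)
    (he_conj : ∀ (m : Fin r) (s : Kf (is m) →+* ℂ), e m (ComplexEmbedding.conjugate s) = ((e m s).1, !(e m s).2))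
    (hΨ : ∀ σ : Kf i₀ →+* ℂ, σ ∈ (Φ 0).1 ↔ σ = τ)
    (hΦ : ∀ (m : Fin r) (s : Kf (is m) →+* ℂ), s ∈ (Φ m.succ).1 ↔ (e m s).2 = decide ((e m s).1 ∈ P m))
    (hW : ∀ m : Fin r, weilClassesOf (⨁ fun i => A (partSlots (n m - 2 * p m) m i))
      (biproduct.map fun i => ι (partSlots (n m - 2 * p m) m i) (δfam im δ (partSlots (n m - 2 * p m) m i))) (n m - p m) d ≤
      algebraicClasses (⨁ fun i => A (partSlots (n m - 2 * p m) m i)).X (n m - p m))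
    {X : AbelianVariety ℂ} (hX : Domination.AVDominatedBy X (⨁ fun j => A (κ j))) : HodgeConjectureFor X.dim X.X :=
  Domination.hodgeConjectureFor_of_avDominatedBy
    (hodgeConjectureFor_biproduct_comp_of_jointPrimeTower_oneMember P p hcard L hpr hLt hcop hp1 hp0 hpn κ h2 im hJ hτ hA e he_sign he_conj hΨ hΦ hW) hX

/-- **INTRINSIC FORM (no frames)**: only `[K_m : ℚ] = 2 n_m`, the `k`-signatures `p_m` and the joint-transitivity hypothesis `hJ`.  `HC_CM` is NOT asserted.
[cite: Pohlmann1968, Thm 1] [cite: Milne2020HodgeClassesAV, 1.2 (a) and Thm. 1] [cite: MoonenZarhin1995Duke, Thm. 2.4] [cite: Shimura1998, §18.2 Lemma (i)] -/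
theorem hodgeConjectureFor_biproduct_comp_of_jointPrimeTower_oneMember_intrinsic (p : Fin r → ℕ) (L : Finset (Fin r))
    (hpr : ∀ m, m ∉ L → (n m).Prime) (hLt : ∀ m ∈ L, ∀ m', m' ∉ L → n m < n m') (hcop : ∀ m ∈ L, ∀ m' ∈ L, m ≠ m' → (n m).Coprime (n m'))
    (hp1 : ∀ m ∈ L, p m = 1) (hp0 : ∀ m, 0 < p m) (hpn : ∀ m, 2 * p m ≤ n m)
    {N : ℕ} (κ : Fin N → Fin (r + 1)) (h2 : Module.finrank ℚ (Kf i₀) = 2) (hdeg : ∀ m : Fin r, Module.finrank ℚ (Kf (is m)) = 2 * n m)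
    (im : ∀ m : Fin r, Kf i₀ →+* Kf (is m))
    (hJ : ∀ m₀, m₀ ∉ L → (∃ m, m ∉ L ∧ m ≠ m₀ ∧ n m = n m₀) →
      ∀ s s' : (∀ m : Fin r, Kf (is m) →+* ℂ), (∀ m, m ∉ L → n m = n m₀ → (s m).comp (im m) = τ ∧ (s' m).comp (im m) = τ) →
        ∃ ρ : ℂ ≃+* ℂ, ∀ m, m ∉ L → n m = n m₀ → (ρ : ℂ →+* ℂ).comp (s m) = s' m)
    {δ : 𝓞 (Kf i₀)} {d : ℕ} (hτ : τ (δ : Kf i₀) = Complex.I * (Real.sqrt d : ℂ))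
    (hA : ∀ j, IsCMTypeRealisation (Φ j) (A j) (ι j) (θ j))
    (hΨ : ∀ σ : Kf i₀ →+* ℂ, σ ∈ (Φ 0).1 ↔ σ = τ)
    (hp : ∀ m : Fin r, (Finset.univ.filter fun s : Kf (is m) →+* ℂ => s.comp (im m) = τ ∧ s ∈ (Φ m.succ).1).card = p m)
    (hW : ∀ m : Fin r, weilClassesOf (⨁ fun i => A (partSlots (n m - 2 * p m) m i))
      (biproduct.map fun i => ι (partSlots (n m - 2 * p m) m i) (δfam im δ (partSlots (n m - 2 * p m) m i))) (n m - p m) d ≤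
      algebraicClasses (⨁ fun i => A (partSlots (n m - 2 * p m) m i)).X (n m - p m)) :
    HodgeConjectureFor (⨁ fun j => A (κ j)).dim (⨁ fun j => A (κ j)).X := by
  have hττ : ComplexEmbedding.conjugate τ ≠ τ := QuarticCM.conjugate_ne τ
  have hk : ∀ σ : Kf i₀ →+* ℂ, σ = τ ∨ σ = ComplexEmbedding.conjugate τ := fun σ => QuarticCM.eq_or_eq_conjugate_of_quadratic h2 τ σ
  have hfr : ∀ m : Fin r, ∃ e : (Kf (is m) →+* ℂ) ≃ Fin (n m) × Bool, (∀ s, (e s).2 = true ↔ s.comp (im m) = τ) ∧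
      ∀ s, e (ComplexEmbedding.conjugate s) = ((e s).1, !(e s).2) := fun m => exists_signFrame (hdeg m) h2 (im m) hττ hk
  choose e he_sign he_conj using hfr
  exact hodgeConjectureFor_biproduct_comp_of_jointPrimeTower_oneMember
    (fun m => Finset.univ.filter fun a : Fin (n m) => (e m).symm (a, true) ∈ (Φ m.succ).1) p
    (fun m => (card_posSet (he_sign m) (Φ m.succ)).trans (hp m)) L hpr hLt hcop hp1 hp0 hpn κ h2 im hJ hτ hA e he_sign he_conj hΨ
    (fun m s => mem_iff_snd_eq_decide_mem_posSet (he_conj m) (Φ m.succ) s) hW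

/-! ## §3 (before §2) Sextic and decic fields together, jointly transitive within each degree -/

/-- **HEADLINE — ANY NUMBER OF SEXTIC `(1,2)` AND DECIC `(2,3)` CM FIELDS SHARING `k` WITH JOINTLY TRANSITIVE EMBEDDINGS WITHIN EACH DEGREE, GIVEN ONLY MARKMAN'S TWO
THEOREMS.**  `(n_m, p_m) ∈ {(3,1), (5,2)}`, `[K_m : ℚ] = 2 n_m`; `hJ`: for each degree occurring at least twice, `Aut(ℂ/τ(k))` carries every tuple of `τ`-embeddings of the
fields of that degree to every other.  Then the Hodge conjecture holds for EVERY product of copies `⨁_j A(κ j)`; no open Weil space enters.  `HC_CM` is NOT asserted.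
[cite: Markman2025SurveySecant, Thm. 1.2] [cite: Markman2025SecantWeil, Thm 1.5.1] [cite: Pohlmann1968, Thm 1] [cite: DixonMortimer1996, §1.6 and Thm. 1.6A] -/
theorem hodgeConjectureFor_biproduct_comp_of_sexticsDecics (hW4 : Markman2025_weilClasses_algebraic_abelianFourfold)
    (hM6 : Markman2025_weilClasses_algebraic_hyperbolicSixfold) (n p : Fin r → ℕ) (hnp : ∀ m, (n m = 3 ∧ p m = 1) ∨ (n m = 5 ∧ p m = 2))
    {N : ℕ} (κ : Fin N → Fin (r + 1)) (h2 : Module.finrank ℚ (Kf i₀) = 2) (hdeg : ∀ m : Fin r, Module.finrank ℚ (Kf (is m)) = 2 * n m)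
    (im : ∀ m : Fin r, Kf i₀ →+* Kf (is m)) (hA : ∀ j, IsCMTypeRealisation (Φ j) (A j) (ι j) (θ j)) (hΨ : ∀ σ : Kf i₀ →+* ℂ, σ ∈ (Φ 0).1 ↔ σ = τ)
    (hp : ∀ m : Fin r, (Finset.univ.filter fun s : Kf (is m) →+* ℂ => s.comp (im m) = τ ∧ s ∈ (Φ m.succ).1).card = p m)
    (hJ : ∀ m₀ : Fin r, (∃ m, m ≠ m₀ ∧ n m = n m₀) →
      ∀ s s' : (∀ m : Fin r, Kf (is m) →+* ℂ), (∀ m, n m = n m₀ → (s m).comp (im m) = τ ∧ (s' m).comp (im m) = τ) →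
        ∃ ρ : ℂ ≃+* ℂ, ∀ m, n m = n m₀ → (ρ : ℂ →+* ℂ).comp (s m) = s' m) :
    HodgeConjectureFor (⨁ fun j => A (κ j)).dim (⨁ fun j => A (κ j)).X := by
  obtain ⟨δ₀, d, hd, hδ₀⟩ := CyclicSextic.exists_sq_eq_neg_nat_of_isTotallyComplex (Kf i₀) h2
  obtain ⟨δ, hδ, hτ⟩ := OcticCurveFourfold.exists_delta_of_mem h2 hd hδ₀ τ
  refine hodgeConjectureFor_biproduct_comp_of_jointPrimeTower_oneMember_intrinsic (is := is) p ∅ (fun m _ => ?_)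
    (fun m hm => absurd hm (Finset.notMem_empty m)) (fun m hm => absurd hm (Finset.notMem_empty m)) (fun m hm => absurd hm (Finset.notMem_empty m))
    (fun m => ?_) (fun m => ?_) κ h2 hdeg im (fun m₀ _ hex s s' hss' => ?_) hτ hA hΨ hp (fun m => ?_)
  · rcases hnp m with ⟨h, -⟩ | ⟨h, -⟩ <;> rw [h] <;> norm_num
  · rcases hnp m with ⟨-, h⟩ | ⟨-, h⟩ <;> omega
  · rcases hnp m with ⟨h, h'⟩ | ⟨h, h'⟩ <;> omega
  · obtain ⟨m, -, hne, hn⟩ := hex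
    obtain ⟨ρ, hρ⟩ := hJ m₀ ⟨m, hne, hn⟩ s s' fun m hn => hss' m (Finset.notMem_empty m) hn
    exact ⟨ρ, fun m _ hn => hρ m hn⟩
  · have hnp' : (n m = 3 ∧ p m = 1) ∨ (n m = 4 ∧ p m = 1) ∨ (n m = 4 ∧ p m = 2) ∨ (n m = 5 ∧ p m = 2) := by
      rcases hnp m with h | h
      · exact Or.inl h
      · exact Or.inr (Or.inr (Or.inr h))
    exact weilHyp_of_markman_intrinsic hW4 hM6 m hnp' (hdeg m) h2 hd hδ hA hΨ (hp m)

/-- **… and for every abelian variety DOMINATED by such a product.** `HC_CM` is NOT asserted. [cite: MumfordAV1970, §19] [cite: Markman2025SurveySecant, Thm. 1.2]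
[cite: Markman2025SecantWeil, Thm 1.5.1] -/
theorem hodgeConjectureFor_of_avDominatedBy_comp_of_sexticsDecics (hW4 : Markman2025_weilClasses_algebraic_abelianFourfold)
    (hM6 : Markman2025_weilClasses_algebraic_hyperbolicSixfold) (n p : Fin r → ℕ) (hnp : ∀ m, (n m = 3 ∧ p m = 1) ∨ (n m = 5 ∧ p m = 2))
    {N : ℕ} (κ : Fin N → Fin (r + 1)) (h2 : Module.finrank ℚ (Kf i₀) = 2) (hdeg : ∀ m : Fin r, Module.finrank ℚ (Kf (is m)) = 2 * n m)
    (im : ∀ m : Fin r, Kf i₀ →+* Kf (is m)) (hA : ∀ j, IsCMTypeRealisation (Φ j) (A j) (ι j) (θ j)) (hΨ : ∀ σ : Kf i₀ →+* ℂ, σ ∈ (Φ 0).1 ↔ σ = τ)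
    (hp : ∀ m : Fin r, (Finset.univ.filter fun s : Kf (is m) →+* ℂ => s.comp (im m) = τ ∧ s ∈ (Φ m.succ).1).card = p m)
    (hJ : ∀ m₀ : Fin r, (∃ m, m ≠ m₀ ∧ n m = n m₀) →
      ∀ s s' : (∀ m : Fin r, Kf (is m) →+* ℂ), (∀ m, n m = n m₀ → (s m).comp (im m) = τ ∧ (s' m).comp (im m) = τ) →
        ∃ ρ : ℂ ≃+* ℂ, ∀ m, n m = n m₀ → (ρ : ℂ →+* ℂ).comp (s m) = s' m)
    {X : AbelianVariety ℂ} (hX : Domination.AVDominatedBy X (⨁ fun j => A (κ j))) : HodgeConjectureFor X.dim X.X :=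
  Domination.hodgeConjectureFor_of_avDominatedBy (hodgeConjectureFor_biproduct_comp_of_sexticsDecics hW4 hM6 n p hnp κ h2 hdeg im hA hΨ hp hJ) hX

/-! ## §2 One degree: sextic fields (Markman's fourfold theorem alone), decic fields (the hyperbolic-sixfold theorem alone) -/

/-- **HEADLINE — ANY NUMBER OF `(1,2)`-THREEFOLDS OVER SEXTIC CM FIELDS SHARING `k` WITH JOINTLY TRANSITIVE EMBEDDINGS, GIVEN ONLY MARKMAN'S FOURFOLD THEOREM.**
`E = A 0 ⊨ (k; {τ})`, `T_m = A (m+1) ⊨ (K_m; Φ (m+1))` over SEXTIC `K_m ⊇ i_m(k)` with ONE member of `Φ (m+1)` over `τ`; `hJ`: `Aut(ℂ)` carries every family `(s_m)_m` of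
`τ`-embeddings to every other family `(s'_m)_m` (for `r = 2` this holds as soon as the sextic fields `K_0`, `K_1` are NOT ISOMORPHIC — the cubic subextensions of the
Galois closure of `K_0 / k` are the conjugates of `K_0`; for general `r` it holds when the Galois closures of the `K_m` over `k` are linearly disjoint).  Then the Hodge
conjecture holds for EVERY product of copies `⨁_j A(κ j)` of `E, T_0, …, T_{r−1}`.  `HC_CM` is NOT asserted. [cite: Markman2025SurveySecant, Thm. 1.2] [cite: Pohlmann1968, Thm 1] [cite: MoonenZarhin1995Duke, Thm. 2.4]
[cite: DixonMortimer1996, §1.6 and Thm. 1.6A] -/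
theorem hodgeConjectureFor_biproduct_comp_of_sextics (hW4 : Markman2025_weilClasses_algebraic_abelianFourfold)
    {N : ℕ} (κ : Fin N → Fin (r + 1)) (h2 : Module.finrank ℚ (Kf i₀) = 2) (h6 : ∀ m : Fin r, Module.finrank ℚ (Kf (is m)) = 6)
    (im : ∀ m : Fin r, Kf i₀ →+* Kf (is m)) (hA : ∀ j, IsCMTypeRealisation (Φ j) (A j) (ι j) (θ j)) (hΨ : ∀ σ : Kf i₀ →+* ℂ, σ ∈ (Φ 0).1 ↔ σ = τ)
    (h1 : ∀ m : Fin r, (Finset.univ.filter fun s : Kf (is m) →+* ℂ => s.comp (im m) = τ ∧ s ∈ (Φ m.succ).1).card = 1)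
    (hJ : ∀ s s' : (∀ m : Fin r, Kf (is m) →+* ℂ), (∀ m, (s m).comp (im m) = τ ∧ (s' m).comp (im m) = τ) →
      ∃ ρ : ℂ ≃+* ℂ, ∀ m, (ρ : ℂ →+* ℂ).comp (s m) = s' m) :
    HodgeConjectureFor (⨁ fun j => A (κ j)).dim (⨁ fun j => A (κ j)).X := by
  obtain ⟨δ₀, d, hd, hδ₀⟩ := CyclicSextic.exists_sq_eq_neg_nat_of_isTotallyComplex (Kf i₀) h2
  obtain ⟨δ, hδ, hτ⟩ := OcticCurveFourfold.exists_delta_of_mem h2 hd hδ₀ τ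
  refine hodgeConjectureFor_biproduct_comp_of_jointPrimeTower_oneMember_intrinsic (is := is) (n := fun _ => 3) (fun _ => 1) ∅ (fun m _ => by norm_num)
    (fun m hm => absurd hm (Finset.notMem_empty m)) (fun m hm => absurd hm (Finset.notMem_empty m)) (fun m hm => absurd hm (Finset.notMem_empty m))
    (fun _ => Nat.one_pos) (fun _ => by norm_num) κ h2 (fun m => by rw [h6 m]) im (fun m₀ _ _ s s' hss' => ?_) hτ hA hΨ h1 fun m => ?_
  · obtain ⟨ρ, hρ⟩ := hJ s s' fun m => hss' m (Finset.notMem_empty m) rfl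
    exact ⟨ρ, fun m _ _ => hρ m⟩
  · exact weilHyp_of_markman_fourfold_intrinsic hW4 m (h6 m) h2 hd hδ hA hΨ (h1 m)

/-- **HEADLINE — ANY NUMBER OF `(2,3)`-FIVEFOLDS OVER DECIC CM FIELDS SHARING `k` WITH JOINTLY TRANSITIVE EMBEDDINGS, GIVEN ONLY MARKMAN'S HYPERBOLIC-SIXFOLD THEOREM.**
As `…_of_sextics` with DECIC `K_m` (`[K_m : ℚ] = 10`) and TWO members of `Φ (m+1)` over `τ`.  `HC_CM` is NOT asserted. [cite: Markman2025SecantWeil, Thm 1.5.1]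
[cite: Pohlmann1968, Thm 1] [cite: MoonenZarhin1995Duke, Thm. 2.4] [cite: DixonMortimer1996, §1.6 and Thm. 1.6A] -/
theorem hodgeConjectureFor_biproduct_comp_of_decics (hM6 : Markman2025_weilClasses_algebraic_hyperbolicSixfold)
    {N : ℕ} (κ : Fin N → Fin (r + 1)) (h2 : Module.finrank ℚ (Kf i₀) = 2) (h10 : ∀ m : Fin r, Module.finrank ℚ (Kf (is m)) = 10)
    (im : ∀ m : Fin r, Kf i₀ →+* Kf (is m)) (hA : ∀ j, IsCMTypeRealisation (Φ j) (A j) (ι j) (θ j)) (hΨ : ∀ σ : Kf i₀ →+* ℂ, σ ∈ (Φ 0).1 ↔ σ = τ)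
    (h23 : ∀ m : Fin r, (Finset.univ.filter fun s : Kf (is m) →+* ℂ => s.comp (im m) = τ ∧ s ∈ (Φ m.succ).1).card = 2)
    (hJ : ∀ s s' : (∀ m : Fin r, Kf (is m) →+* ℂ), (∀ m, (s m).comp (im m) = τ ∧ (s' m).comp (im m) = τ) →
      ∃ ρ : ℂ ≃+* ℂ, ∀ m, (ρ : ℂ →+* ℂ).comp (s m) = s' m) :
    HodgeConjectureFor (⨁ fun j => A (κ j)).dim (⨁ fun j => A (κ j)).X := by
  obtain ⟨δ₀, d, hd, hδ₀⟩ := CyclicSextic.exists_sq_eq_neg_nat_of_isTotallyComplex (Kf i₀) h2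
  obtain ⟨δ, hδ, hτ⟩ := OcticCurveFourfold.exists_delta_of_mem h2 hd hδ₀ τ
  refine hodgeConjectureFor_biproduct_comp_of_jointPrimeTower_oneMember_intrinsic (is := is) (n := fun _ => 5) (fun _ => 2) ∅ (fun m _ => by norm_num)
    (fun m hm => absurd hm (Finset.notMem_empty m)) (fun m hm => absurd hm (Finset.notMem_empty m)) (fun m hm => absurd hm (Finset.notMem_empty m))
    (fun _ => Nat.succ_pos 1) (fun _ => by norm_num) κ h2 (fun m => by rw [h10 m]) im (fun m₀ _ _ s s' hss' => ?_) hτ hA hΨ h23 fun m => ?_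
  · obtain ⟨ρ, hρ⟩ := hJ s s' fun m => hss' m (Finset.notMem_empty m) rfl
    exact ⟨ρ, fun m _ _ => hρ m⟩
  · exact weilHyp_of_markman_sixfold_decic_intrinsic hM6 m (h10 m) h2 hd hδ hA hΨ (h23 m)

end Summit.HodgeConjecture.CorCM.MultiFieldWeil

end
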